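import Summits.BirchSwinnertonDyer.BirchSwinnertonDyer.Theorems.KolyvaginRoadThreeMethod2KolyvaginIsoBoundCore
import Summits.BirchSwinnertonDyer.BirchSwinnertonDyer.Theorems.KolyvaginRoadThreeMethod2KolyvaginLine
import HarnessLib

/-!
# KOLY method line, crux stmt-BirchSwinnertonDyer-19574 `ZhangSharpFrameAtThreeHL`, stub S2-ENGINE: LOCAL LINE-RIGIDITY AT A
# KOLYVAGIN PRIME, I — a ramified eigen-cocycle with isotropic self-cup-product has Frobenius value `0`
# (cell `bsd-stepL`, seat `bsd-stepL-zhang3-p1` g10; `--supports 19574`, helper)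

HONEST FRAMING. Theorems only; 0 definitions, 0 named facts, 0 `sorry`; local Galois cohomology at a Kolyvagin prime of
the Hoffstein–Luo frame (`K` imaginary quadratic, `ρ̄_{E,3}` onto); closes nothing (T7). PARTITION: O2@3 (B10) × A1 ×
crux 19574 × the S2-ENGINE's (Supply) binder `hbound` (koly3b `ZhangSupply.supply_signed_of_jump_bound`) — proves-glue.

WHAT (towards `hbound`, completed in `…KolyvaginIsoBound`).
* `twoCocycleClass_cupCocycle_add_eq_zero_of_proj` — for local cocycles `f = u + w` decomposed along an additive
  projection `pr` with isotropic images (`u = pr ∘ f`, `w = f - u`), `[f ∪ₑ f] + [u ∪ₑ w] = 0`: the `2`-cocycle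
  `f ∪ₑ f + u ∪ₑ w` is `(σ, τ) ↦ B(f σ, f τ)` for the SYMMETRIC bi-additive `B(a, b) = -e(pr b, a) - e(pr a, b)`
  (`-2 ≡ 1 (mod 3)`, antisymmetry of `e`), hence a coboundary (`twoCocycleClass_eq_zero_of_symmetric`, `3` odd).
* `apply_frob_eq_zero_of_self_cup_eq_zero` — a LOCAL cocycle `f : Γ_{K_λ} → E[3]` whose Frobenius value is a
  `ν`-eigenvector and whose inertia values are `(-ν)`-eigenvectors of an involution `t` of `E[3]`, RAMIFIED, with
  `[f ∪ₑ f] = 0`, has Frobenius value `0`: otherwise, with `pr = pr_ν` the `ν`-eigen-projection `a ↦ 2 (a + ν t a)`,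
  `u = pr ∘ f` is unramified of rank one along `P = f(g_F) ≠ 0` and `w = f - u` has the non-zero inertia value, so
  `[u ∪ₑ w] ≠ 0` by the local (Perf) core `twoCocycleClass_weilCupCocycle_ne_zero` (p523637), while
  `[u ∪ₑ w] = -[f ∪ₑ f] = 0` by the first bullet.
This is the content of W. Zhang's Lemma 8.4 (1) / Gross's Prop. 8.1 at a Kolyvagin prime: `H¹(K_λ, E[3])^{s} =
H¹_f^{s} ⊕ H¹_tr^{s}` is a hyperbolic plane for the local Tate pairing, so its isotropic vectors lie on the two lines.
[cite: WZhang2014, Lemma 8.4, §8.1] [cite: GrossLMS1991, Prop. 8.1, 8.2, 9.6] [cite: MazurRubin2004, Prop. 1.3.2]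
-/

noncomputable section

open scoped Classical Pointwise

namespace Summit.BirchSwinnertonDyer.Rank1Residual.X11b.Three.Koly.Method2.KolyLocal

open CategoryTheory WeierstrassCurve Field Function NumberField IsDedekindDomain
open Literature.NumberTheory.EllipticCurves Literature.NumberTheory.EllipticCurves.ModularForms
  Literature.NumberTheory.GaloisRepresentations Module
open Literature.NumberTheory.GaloisRepresentations.DiscreteGaloisModule (mu MuCarrier tateDual tateDualEval TateDual)
open Literature.NumberTheory.GaloisCohomology
open Summit.BirchSwinnertonDyer.Rank1Residual.X11b.Three.Koly.Method2
open Summit.BirchSwinnertonDyer.Rank1Residual.GaloisImage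
open scoped ContRepresentation

attribute [local instance] absoluteGaloisGroup_compactSpace
attribute [local instance] finite_geomTorsion_of_neZero

/-! ## §0 Eigen-projection algebra for an involution of a `3`-torsion group -/

section Projection

variable {A : Type*} [AddCommGroup A] (t : A →+ A)

/-- The `ν`-eigen-projection `a ↦ 2 (a + ν t a)` fixes `ν`-eigenvectors (`3 a = 0`, `4 ≡ 1`). [folklore] -/
private theorem proj_eq_self_of_eigen (h3 : ∀ a : A, 3 • a = 0) {ν : ℤ} (hν : ν = 1 ∨ ν = -1) {a : A}
    (ha : t a = ν • a) : (2 : ℤ) • (a + ν • t a) = a := by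
  have key : (2 : ℤ) • (a + ν • t a) = a + 3 • a := by
    rw [ha, smul_smul]
    rcases hν with rfl | rfl
    · simp only [mul_one, one_smul]; abel
    · simp only [mul_neg, mul_one, neg_neg, one_smul]; abel
  rw [key, h3, add_zero]

/-- The `ν`-eigen-projection kills `(-ν)`-eigenvectors. [folklore] -/
private theorem proj_eq_zero_of_eigen_neg {ν : ℤ} (hν : ν = 1 ∨ ν = -1) {a : A} (ha : t a = -(ν • a)) :
    (2 : ℤ) • (a + ν • t a) = 0 := by
  rw [ha, smul_neg, smul_smul]
  rcases hν with rfl | rfl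
  · simp only [mul_one, one_smul, add_neg_cancel, smul_zero]
  · simp only [mul_neg, mul_one, neg_neg, one_smul, add_neg_cancel, smul_zero]

/-- The `ν`-eigen-projection takes values in the `ν`-eigenspace (`t² = 1`). [folklore] -/
private theorem apply_proj_eq (htt : ∀ a, t (t a) = a) {ν : ℤ} (hν : ν = 1 ∨ ν = -1) (a : A) :
    t ((2 : ℤ) • (a + ν • t a)) = ν • ((2 : ℤ) • (a + ν • t a)) := by
  rw [map_zsmul, map_add, map_zsmul, htt]
  rcases hν with rfl | rfl
  · simp only [one_smul]; abel
  · simp only [neg_smul, one_smul]; abel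

/-- The complementary projection `a - pr_ν a` takes values in the `(-ν)`-eigenspace (`t² = 1`, `3 a = 0`). [folklore] -/
private theorem apply_sub_proj_eq (htt : ∀ a, t (t a) = a) (h3 : ∀ a : A, 3 • a = 0) {ν : ℤ}
    (hν : ν = 1 ∨ ν = -1) (a : A) :
    t (a - (2 : ℤ) • (a + ν • t a)) = -(ν • (a - (2 : ℤ) • (a + ν • t a))) := by
  have h3a := h3 a
  have h3t := h3 (t a)
  rw [map_sub, map_zsmul, map_add, map_zsmul, htt, ← sub_eq_zero]
  rcases hν with rfl | rfl
  · calc _ = -((3 • a) + 3 • t a) := by simp only [one_smul]; abel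
      _ = 0 := by rw [h3a, h3t, add_zero, neg_zero]
  · calc _ = (3 • a) - 3 • t a := by simp only [neg_smul, one_smul, neg_neg]; abel
      _ = 0 := by rw [h3a, h3t, sub_zero]

end Projection

variable (W : WeierstrassCurve ℚ) (K : Type) [Field K] [NumberField K] [W.IsElliptic] [W.IsGloballyMinimal]

/-! ## §1 The symmetric part of `f ∪ f` for an eigen-decomposition `f = u + w` -/

omit [W.IsElliptic] [W.IsGloballyMinimal] in
/-- **`[f ∪ₑ f] + [u ∪ₑ w] = 0` for a decomposition `f = u + w` along complementary isotropic projections.** Local, at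
a finite place `v` where `Γ_{K_v}` fixes `E[3]` and `μ₃` (hypotheses `hfixA`, `hfixμ`): for an additive
`pr : E[3] → E[3]` with `e(pr a, pr b) = 1 = e(a - pr a, b - pr b)` (both projections have isotropic images) and
local cocycles `f, u, w` with `u = pr ∘ f`, `w = f - u` pointwise, the `2`-cocycle `f ∪ₑ f + u ∪ₑ w` is
`(σ, τ) ↦ B(f σ, f τ)` with `B(a, b) = -e(pr b, a) - e(pr a, b)` (additively; `-2 ≡ 1 (mod 3)` and the antisymmetry
of `e`), symmetric and bi-additive, hence a coboundary (`twoCocycleClass_eq_zero_of_symmetric`).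
[cite: MazurRubin2004, Prop. 1.3.2 (proof)] [cite: WZhang2014, Lemma 8.4 (1)] -/
theorem twoCocycleClass_cupCocycle_add_eq_zero_of_proj
    (e : geomTorsion (W.baseChange K) ((3 ^ 1 : ℕ) : ℤ) → geomTorsion (W.baseChange K) ((3 ^ 1 : ℕ) : ℤ) →
      AlgebraicClosure K)
    (hμ : ∀ P Q, e P Q ^ (3 ^ 1) = 1) (hadd₁ : ∀ P₁ P₂ Q, e (P₁ + P₂) Q = e P₁ Q * e P₂ Q)
    (hadd₂ : ∀ P Q₁ Q₂, e P (Q₁ + Q₂) = e P Q₁ * e P Q₂) (halt : ∀ Q, e Q Q = 1)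
    (hgal : ∀ (σ : absoluteGaloisGroup K) (P Q : geomTorsion (W.baseChange K) ((3 ^ 1 : ℕ) : ℤ)),
      σ • e P Q = e (σ • P) (σ • Q))
    (v : HeightOneSpectrum (𝓞 K))
    (hfixA : ∀ (g : absoluteGaloisGroup (v.adicCompletion K)) (Q : geomTorsion (W.baseChange K) ((3 ^ 1 : ℕ) : ℤ)),
      absGaloisRestrict K (v.adicCompletion K) g • Q = Q)
    (hfixμ : ∀ (g : absoluteGaloisGroup (v.adicCompletion K)) (z : MuCarrier K (3 ^ 1)),
      mu K (3 ^ 1) (absGaloisRestrict K (v.adicCompletion K) g) z = z)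
    (pr : geomTorsion (W.baseChange K) ((3 ^ 1 : ℕ) : ℤ) →+ geomTorsion (W.baseChange K) ((3 ^ 1 : ℕ) : ℤ))
    (hprpr : ∀ a b, weilPairingHom (W.baseChange K) (3 ^ 1) e hμ hadd₁ hadd₂ (pr a) (pr b) = 0)
    (hsubsub : ∀ a b, weilPairingHom (W.baseChange K) (3 ^ 1) e hμ hadd₁ hadd₂ (a - pr a) (b - pr b) = 0)
    (f u w : contOneCocycles (DiscreteGaloisModule.toLocal ((W.baseChange K).torsionGaloisModule ((3 ^ 1 : ℕ) : ℤ))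
      (Sum.inr v)).toTopRep)
    (hu : ∀ g, u.1 g = pr (f.1 g)) (hw : ∀ g, w.1 g = f.1 g - pr (f.1 g)) :
    twoCocycleClass _
      ((weilContPairingLocal (W.baseChange K) (3 ^ 1) e hμ hadd₁ hadd₂ hgal (Sum.inr v)).cupCocycle f f +
        (weilContPairingLocal (W.baseChange K) (3 ^ 1) e hμ hadd₁ hadd₂ hgal (Sum.inr v)).cupCocycle u w) = 0 := by
  haveI : NeZero (3 ^ 1 : ℕ) := ⟨by norm_num⟩
  have hμ3 : ∀ z : MuCarrier K (3 ^ 1), 3 • z = 0 := fun z ↦ by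
    rw [← natCast_zsmul]; exact zsmul_muCarrier_eq_zero K (3 ^ 1) z
  have hf_add : ∀ g g', f.1 (g * g') = f.1 g + f.1 g' := fun g g' ↦
    (f.2 g g').trans (congrArg (fun Q ↦ f.1 g + Q) (hfixA g (f.1 g')))
  obtain ⟨W₀, hW₀⟩ : ∃ W₀, W₀ = weilPairingHom (W.baseChange K) (3 ^ 1) e hμ hadd₁ hadd₂ := ⟨_, rfl⟩
  have hW₀self : ∀ a, W₀ a a = 0 := fun a ↦ by
    rw [hW₀]; exact weilPairingHom_self (W.baseChange K) (3 ^ 1) e hμ hadd₁ hadd₂ halt a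
  have hW₀anti : ∀ a b, W₀ b a = -W₀ a b := fun a b ↦ KolyvaginReciprocity.pairing_antisymm W₀ hW₀self a b
  rw [← hW₀] at hprpr hsubsub
  -- ### `W₀ a b` through the decomposition `a = pr a + (a - pr a)`
  have hkey : ∀ a b, W₀ a b = W₀ (pr a) (b - pr b) + W₀ (a - pr a) (pr b) := fun a b ↦ by
    calc W₀ a b = W₀ (pr a + (a - pr a)) (pr b + (b - pr b)) := by rw [add_sub_cancel, add_sub_cancel]
      _ = W₀ (pr a) (pr b) + W₀ (pr a) (b - pr b) + (W₀ (a - pr a) (pr b) + W₀ (a - pr a) (b - pr b)) := by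
        simp only [map_add, AddMonoidHom.add_apply]; abel
      _ = W₀ (pr a) (b - pr b) + W₀ (a - pr a) (pr b) := by rw [hprpr a b, hsubsub a b, zero_add, add_zero]
  have hX : ∀ a b, W₀ (pr a) (b - pr b) = W₀ (pr a) b := fun a b ↦ by
    rw [map_sub (W₀ (pr a)) b (pr b), hprpr a b, sub_zero]
  have hY : ∀ a b, W₀ (a - pr a) (pr b) = -W₀ (pr b) a := fun a b ↦ by
    rw [hW₀anti (pr b) (a - pr a), map_sub (W₀ (pr b)) a (pr a), hprpr b a, sub_zero]
  have hkey₂ : ∀ a b, W₀ a b = W₀ (pr a) b + -W₀ (pr b) a := fun a b ↦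
    (hkey a b).trans (congrArg₂ (· + ·) (hX a b) (hY a b))
  -- ### the cocycle values
  have h1 : ∀ σ τ, ((weilContPairingLocal (W.baseChange K) (3 ^ 1) e hμ hadd₁ hadd₂ hgal (Sum.inr v)).cupCocycle f
      f).1 (σ, τ) = W₀ (f.1 σ) (f.1 τ) := fun σ τ ↦ by
    rw [ContPairing.cupCocycle_apply_eq_smul, weilContPairingLocal_toLin_apply, hW₀]
    exact congrArg (fun Q ↦ weilPairingHom (W.baseChange K) (3 ^ 1) e hμ hadd₁ hadd₂ (f.1 σ) Q) (hfixA σ (f.1 τ))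
  have h2 : ∀ σ τ, ((weilContPairingLocal (W.baseChange K) (3 ^ 1) e hμ hadd₁ hadd₂ hgal (Sum.inr v)).cupCocycle u
      w).1 (σ, τ) = W₀ (pr (f.1 σ)) (f.1 τ - pr (f.1 τ)) := fun σ τ ↦ by
    rw [ContPairing.cupCocycle_apply_eq_smul, weilContPairingLocal_toLin_apply, hW₀, hu, ← hw τ]
    exact congrArg (fun Q ↦ weilPairingHom (W.baseChange K) (3 ^ 1) e hμ hadd₁ hadd₂ (pr (f.1 σ)) Q) (hfixA σ (w.1 τ))
  have hc : ∀ σ τ, ((weilContPairingLocal (W.baseChange K) (3 ^ 1) e hμ hadd₁ hadd₂ hgal (Sum.inr v)).cupCocycle f f +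
      (weilContPairingLocal (W.baseChange K) (3 ^ 1) e hμ hadd₁ hadd₂ hgal (Sum.inr v)).cupCocycle u w).1 (σ, τ) =
        -W₀ (pr (f.1 τ)) (f.1 σ) - W₀ (pr (f.1 σ)) (f.1 τ) := by
    intro σ τ
    calc _ = ((weilContPairingLocal (W.baseChange K) (3 ^ 1) e hμ hadd₁ hadd₂ hgal (Sum.inr v)).cupCocycle f f).1
          (σ, τ) + ((weilContPairingLocal (W.baseChange K) (3 ^ 1) e hμ hadd₁ hadd₂ hgal (Sum.inr v)).cupCocycle u
            w).1 (σ, τ) := rfl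
      _ = W₀ (f.1 σ) (f.1 τ) + W₀ (pr (f.1 σ)) (f.1 τ - pr (f.1 τ)) := congrArg₂ (· + ·) (h1 σ τ) (h2 σ τ)
      _ = W₀ (pr (f.1 σ)) (f.1 τ) + -W₀ (pr (f.1 τ)) (f.1 σ) + W₀ (pr (f.1 σ)) (f.1 τ) :=
        congrArg₂ (· + ·) (hkey₂ (f.1 σ) (f.1 τ)) (hX (f.1 σ) (f.1 τ))
      _ = _ := by
        rw [← sub_eq_zero]
        calc _ = 3 • W₀ (pr (f.1 σ)) (f.1 τ) := by abel
          _ = 0 := hμ3 _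
  exact twoCocycleClass_eq_zero_of_symmetric _ f.1 hf_add (fun a b ↦ -W₀ (pr b) a - W₀ (pr a) b)
    (fun a a' b ↦ by simp only [map_add, AddMonoidHom.add_apply]; abel)
    (fun a b b' ↦ by simp only [map_add, AddMonoidHom.add_apply]; abel)
    (fun σ τ ↦ by abel) (fun σ τ ↦ hμ3 _) (fun g σ τ ↦ hfixμ g _) _ hc

/-! ## §2 A ramified eigen-cocycle with isotropic self-cup-product has Frobenius value `0` -/

/-- **A ramified eigen-cocycle with isotropic self-cup-product has Frobenius value `0`.** Local, at a Kolyvagin prime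
`λ ∋ ℓ` of the HL frame (so `Γ_λ` fixes `E[3]` and `μ₃`): `fx : Γ_{K_λ} → E[3]` a continuous cocycle whose value at a
lift `g_F` of an arithmetic Frobenius `F` at `𝔓 ∣ λ` is a `ν`-eigenvector of the involution `tM` and whose values above
`I_𝔓` are `(-ν)`-eigenvectors, with a non-zero inertia value, and `[fx ∪ₑ fx] = 0` in `H²(K_λ, μ₃)`. Then `fx(g_F) = 0`.
See the module docstring for the proof (`fx = u + w`, `[fx ∪ fx] = 2[u ∪ w] ≠ 0`).
[cite: WZhang2014, Lemma 8.4 (1)] [cite: GrossLMS1991, Prop. 8.1] [cite: MazurRubin2004, Prop. 1.3.2 (proof)] -/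
theorem apply_frob_eq_zero_of_self_cup_eq_zero (hK : IsImaginaryQuadratic K) (hsurj : W.HasSurjectiveModNGaloisRep 3)
    (e : geomTorsion (W.baseChange K) ((3 ^ 1 : ℕ) : ℤ) → geomTorsion (W.baseChange K) ((3 ^ 1 : ℕ) : ℤ) →
      AlgebraicClosure K)
    (hμ : ∀ P Q, e P Q ^ (3 ^ 1) = 1) (hadd₁ : ∀ P₁ P₂ Q, e (P₁ + P₂) Q = e P₁ Q * e P₂ Q)
    (hadd₂ : ∀ P Q₁ Q₂, e P (Q₁ + Q₂) = e P Q₁ * e P Q₂) (halt : ∀ Q, e Q Q = 1)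
    (hnondeg : ∀ Q, (∀ P, e P Q = 1) → Q = 0)
    (hgal : ∀ (σ : absoluteGaloisGroup K) (P Q : geomTorsion (W.baseChange K) ((3 ^ 1 : ℕ) : ℤ)),
      σ • e P Q = e (σ • P) (σ • Q))
    {ℓ : ℕ} (hℓ : Zhang2014.IsKolyvaginPrime (W.conductorNorm ℤ) W K 3 ℓ) (v : HeightOneSpectrum (𝓞 K))
    (hv : (ℓ : 𝓞 K) ∈ v.asIdeal) {𝔐 : Ideal (HeightOneSpectrum.localAbsIntegers v)} (h𝔐 : 𝔐 ∈ v.localPrimesAbove)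
    {F : absoluteGaloisGroup K} (hF : IsArithFrobAt (𝓞 K) F (v.primeBelow (closureEmb (K := K) (v.adicCompletion K)) 𝔐))
    {gF : absoluteGaloisGroup (v.adicCompletion K)} (hgF : absGaloisRestrict K (v.adicCompletion K) gF = F)
    (tM : geomTorsion (W.baseChange K) ((3 ^ 1 : ℕ) : ℤ) →+ geomTorsion (W.baseChange K) ((3 ^ 1 : ℕ) : ℤ))
    (htt : ∀ a, tM (tM a) = a) {ν : ℤ} (hν : ν = 1 ∨ ν = -1)
    (fx : contOneCocycles (DiscreteGaloisModule.toLocal ((W.baseChange K).torsionGaloisModule ((3 ^ 1 : ℕ) : ℤ))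
      (Sum.inr v)).toTopRep)
    (hPν : tM (fx.1 gF) = ν • fx.1 gF)
    (hIν : ∀ g, absGaloisRestrict K (v.adicCompletion K) g ∈
      (v.primeBelow (closureEmb (K := K) (v.adicCompletion K)) 𝔐).inertia (absoluteGaloisGroup K) →
      tM (fx.1 g) = -(ν • fx.1 g))
    (hram : ∃ g, absGaloisRestrict K (v.adicCompletion K) g ∈
      (v.primeBelow (closureEmb (K := K) (v.adicCompletion K)) 𝔐).inertia (absoluteGaloisGroup K) ∧ fx.1 g ≠ 0)
    (hxx : twoCocycleClass _
      ((weilContPairingLocal (W.baseChange K) (3 ^ 1) e hμ hadd₁ hadd₂ hgal (Sum.inr v)).cupCocycle fx fx) = 0) :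
    fx.1 gF = 0 := by
  classical
  by_contra hP0
  haveI : NeZero (3 ^ 1 : ℕ) := ⟨by norm_num⟩
  haveI : Fact (Nat.Prime 3) := ⟨Nat.prime_three⟩
  -- ### `Γ_λ` fixes `E[3]` and `μ₃`
  have hℓG := isKolyvaginPrime_three_of_zhang W K hK hsurj hℓ
  have hD : ∀ d ∈ (v.primeBelow (closureEmb (K := K) (v.adicCompletion K)) 𝔐).decompositionSubgroup (absoluteGaloisGroup K),
      d ∈ torsionFixing (W.baseChange K) ((3 ^ 1 : ℕ) : ℤ) := fun d hd ↦
    decompositionSubgroup_le_torsionFixing W K hK hℓ v hv h𝔐 hd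
  have hres : ∀ g : absoluteGaloisGroup (v.adicCompletion K), absGaloisRestrict K (v.adicCompletion K) g ∈
      (v.primeBelow (closureEmb (K := K) (v.adicCompletion K)) 𝔐).decompositionSubgroup (absoluteGaloisGroup K) :=
    fun g ↦ by
    rw [← resGal_eq_absGaloisRestrict, resGal_eq]; exact resGalOfEmb_mem_decompositionSubgroup _ h𝔐 g
  have hfixA : ∀ (g : absoluteGaloisGroup (v.adicCompletion K)) (Q : geomTorsion (W.baseChange K) ((3 ^ 1 : ℕ) : ℤ)),
      absGaloisRestrict K (v.adicCompletion K) g • Q = Q := fun g Q ↦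
    smul_eq_of_mem_torsionFixing (W.baseChange K) _ (hD _ (hres g)) Q
  have hfixμ : ∀ (g : absoluteGaloisGroup (v.adicCompletion K)) (z : MuCarrier K (3 ^ 1)),
      mu K (3 ^ 1) (absGaloisRestrict K (v.adicCompletion K) g) z = z := by
    intro g z
    apply MuCarrier.toAdditive.injective
    rw [DiscreteGaloisModule.mu_apply_apply]
    apply Additive.toMul.injective
    rw [toMul_ofMul]
    apply Subtype.ext
    apply Units.ext
    rw [absoluteGaloisGroup.coe_smul_rootsOfUnity, Units.coe_smul]
    have hz : ((((MuCarrier.toAdditive z).toMul : rootsOfUnity (3 ^ 1) (AlgebraicClosure K)) : (AlgebraicClosure K)ˣ) :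
        AlgebraicClosure K) ^ (3 ^ 1) = 1 := by
      have := ((MuCarrier.toAdditive z).toMul).2
      rw [mem_rootsOfUnity] at this
      rw [← Units.val_pow_eq_pow_val, this, Units.val_one]
    exact smul_eq_self_of_pow_three_eq_one_of_mem_torsionFixing W K e hμ hnondeg hgal (hD _ (hres g)) hz
  have hpT : ∀ Q : geomTorsion (W.baseChange K) ((3 ^ 1 : ℕ) : ℤ), 3 • Q = 0 := fun Q ↦ by
    have := (mem_geomTorsion_iff (W.baseChange K) ((3 ^ 1 : ℕ) : ℤ) _).mp Q.2
    apply Subtype.ext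
    rw [AddSubgroupClass.coe_nsmul, ← natCast_zsmul]
    exact this
  have hcard : Nat.card (geomTorsion (W.baseChange K) ((3 ^ 1 : ℕ) : ℤ)) = 3 ^ 2 :=
    card_torsionPoints_eq_sq_holds (W.baseChange K) (AlgebraicClosure K) (n := 3) (by norm_num)
  have hfx_add : ∀ g g', fx.1 (g * g') = fx.1 g + fx.1 g' := fun g g' ↦
    (fx.2 g g').trans (congrArg (fun Q ↦ fx.1 g + Q) (hfixA g (fx.1 g')))
  obtain ⟨W₀, hW₀⟩ : ∃ W₀, W₀ = weilPairingHom (W.baseChange K) (3 ^ 1) e hμ hadd₁ hadd₂ := ⟨_, rfl⟩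
  have hW₀self : ∀ a, W₀ a a = 0 := fun a ↦ by
    rw [hW₀]; exact weilPairingHom_self (W.baseChange K) (3 ^ 1) e hμ hadd₁ hadd₂ halt a
  have hW₀line : ∀ {R a b : geomTorsion (W.baseChange K) ((3 ^ 1 : ℕ) : ℤ)}, a ∈ AddSubgroup.zmultiples R →
      b ∈ AddSubgroup.zmultiples R → W₀ a b = 0 := by
    intro R a b ha hb
    obtain ⟨k, rfl⟩ := AddSubgroup.mem_zmultiples_iff.mp ha
    obtain ⟨k', rfl⟩ := AddSubgroup.mem_zmultiples_iff.mp hb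
    rw [map_zsmul (W₀ (k • R)) k' R, show W₀ (k • R) R = W₀.flip R (k • R) from rfl, map_zsmul, AddMonoidHom.flip_apply,
      hW₀self, smul_zero, smul_zero]
  -- ### the ramified value `Q = fx g₀`; the two eigen-lines `ℤ P`, `ℤ Q` (`P = fx g_F`)
  obtain ⟨g₀, hg₀I, hQ0⟩ := hram
  have hQν : tM (fx.1 g₀) = -(ν • fx.1 g₀) := hIν g₀ hg₀I
  have hePQ : e (fx.1 gF) (fx.1 g₀) ≠ 1 :=
    weil_ne_one_of_eigen W K e hμ hadd₁ hadd₂ halt hnondeg tM hν hPν hP0 hQν hQ0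
  have hWPQ : W₀ (fx.1 gF) (fx.1 g₀) ≠ 0 := fun h0 ↦
    hePQ (by rw [hW₀, muCarrier_eq_iff, coe_weilPairingHom] at h0; exact h0)
  have hν' : -ν = 1 ∨ -ν = -1 := by rcases hν with rfl | rfl <;> simp
  have hEp : ∀ a, tM a = ν • a → a ∈ AddSubgroup.zmultiples (fx.1 gF) := fun a ha ↦
    mem_zmultiples_of_eigen_of_eigen Nat.prime_three (by norm_num) hcard hpT tM hν hP0 hPν hQ0 hQν ha
  have hEm : ∀ a, tM a = -(ν • a) → a ∈ AddSubgroup.zmultiples (fx.1 g₀) := fun a ha ↦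
    mem_zmultiples_of_eigen_of_eigen Nat.prime_three (by norm_num) hcard hpT tM hν' hQ0 (by rw [neg_smul]; exact hQν) hP0
      (by rw [neg_smul, neg_neg]; exact hPν) (by rw [neg_smul]; exact ha)
  -- ### the `ν`-eigen-projection `pr` and the cocycles `u = pr ∘ fx` (unramified), `w = fx - u`
  obtain ⟨pr, hpr⟩ : ∃ pr : geomTorsion (W.baseChange K) ((3 ^ 1 : ℕ) : ℤ) →+
      geomTorsion (W.baseChange K) ((3 ^ 1 : ℕ) : ℤ), ∀ a, pr a = (2 : ℤ) • (a + ν • tM a) :=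
    ⟨AddMonoidHom.mk' (fun a ↦ (2 : ℤ) • (a + ν • tM a)) fun a b ↦ by
      rw [map_add, smul_add ν, add_add_add_comm, smul_add], fun _ ↦ rfl⟩
  have hpr_line : ∀ a, pr a ∈ AddSubgroup.zmultiples (fx.1 gF) := fun a ↦
    hEp _ (by rw [hpr]; exact apply_proj_eq tM htt hν a)
  have hsub_line : ∀ a, a - pr a ∈ AddSubgroup.zmultiples (fx.1 g₀) := fun a ↦
    hEm _ (by rw [hpr]; exact apply_sub_proj_eq tM htt hpT hν a)
  have hprP : pr (fx.1 gF) = fx.1 gF := by rw [hpr]; exact proj_eq_self_of_eigen tM hpT hν hPν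
  have hprI : ∀ g, absGaloisRestrict K (v.adicCompletion K) g ∈
      (v.primeBelow (closureEmb (K := K) (v.adicCompletion K)) 𝔐).inertia (absoluteGaloisGroup K) → pr (fx.1 g) = 0 :=
    fun g hg ↦ by rw [hpr]; exact proj_eq_zero_of_eigen_neg tM hν (hIν g hg)
  obtain ⟨u, hudef⟩ : ∃ u : contOneCocycles (DiscreteGaloisModule.toLocal ((W.baseChange K).torsionGaloisModule
      ((3 ^ 1 : ℕ) : ℤ)) (Sum.inr v)).toTopRep,
      u = ⟨(⟨pr, continuous_of_discreteTopology⟩ : C(geomTorsion (W.baseChange K) ((3 ^ 1 : ℕ) : ℤ),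
        geomTorsion (W.baseChange K) ((3 ^ 1 : ℕ) : ℤ))).comp fx.1, (mem_contOneCocycles_iff _).mpr fun g h ↦ by
          rw [ContinuousMap.comp_apply, ContinuousMap.comp_apply, ContinuousMap.comp_apply, ContinuousMap.coe_mk,
            hfx_add, map_add]
          exact congrArg (fun Q ↦ pr (fx.1 g) + Q) (hfixA g (pr (fx.1 h))).symm⟩ := ⟨_, rfl⟩
  have hu : ∀ g, u.1 g = pr (fx.1 g) := fun g ↦ by rw [hudef]; rfl
  obtain ⟨w, hwdef⟩ : ∃ w : contOneCocycles (DiscreteGaloisModule.toLocal ((W.baseChange K).torsionGaloisModule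
      ((3 ^ 1 : ℕ) : ℤ)) (Sum.inr v)).toTopRep, w = fx - u := ⟨_, rfl⟩
  have hw : ∀ g, w.1 g = fx.1 g - pr (fx.1 g) := fun g ↦ by
    rw [hwdef, Submodule.coe_sub, ContinuousMap.sub_apply, hu]
  have huF : u.1 gF = fx.1 gF := (hu gF).trans hprP
  have huI : ∀ g, absGaloisRestrict K (v.adicCompletion K) g ∈
      (v.primeBelow (closureEmb (K := K) (v.adicCompletion K)) 𝔐).inertia (absoluteGaloisGroup K) → u.1 g = 0 :=
    fun g hg ↦ (hu g).trans (hprI g hg)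
  have hwg₀ : w.1 g₀ = fx.1 g₀ := by rw [hw, hprI g₀ hg₀I, sub_zero]
  -- ### `[u ∪ w] ≠ 0` (the local (Perf) core)
  have huw : twoCocycleClass _
      ((weilContPairingLocal (W.baseChange K) (3 ^ 1) e hμ hadd₁ hadd₂ hgal (Sum.inr v)).cupCocycle u w) ≠ 0 :=
    twoCocycleClass_weilCupCocycle_ne_zero W K hK hsurj e hμ hadd₁ hadd₂ hnondeg hgal hℓ v hv h𝔐 hF hgF u w huI
      (by rw [huF]; exact hP0) ⟨g₀, hg₀I, by rw [huF, hwg₀, ← hW₀]; exact hWPQ⟩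
  -- ### `[fx ∪ fx] + [u ∪ w] = 0` (symmetric part) with `[fx ∪ fx] = 0`: contradiction
  have hsymm0 := twoCocycleClass_cupCocycle_add_eq_zero_of_proj W K e hμ hadd₁ hadd₂ halt hgal v hfixA hfixμ pr
    (fun a b ↦ by rw [← hW₀]; exact hW₀line (hpr_line a) (hpr_line b))
    (fun a b ↦ by rw [← hW₀]; exact hW₀line (hsub_line a) (hsub_line b)) fx u w hu hw
  rw [twoCocycleClass_add, hxx, zero_add] at hsymm0
  exact huw hsymm0

end Summit.BirchSwinnertonDyer.Rank1Residual.X11b.Three.Koly.Method2.KolyLocal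

end
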